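import Summits.AtomisticToContinuum.FouriersLaw.Theorems.BondHeatUncertaintyBoundedResponseThoulessWindowB

/-!
# NODE 106 «ThoulessWindow» — part C of 3 (sequel of `…ThoulessWindowB`): §6 windowed algebraic decay seams, §7 gap-rate seams and the `boundedResponse_of_…` doors

Split for the 400-line cap by the landing lane (hand-2 g38) — 3-way cut at node l.300 / l.530 per lens-1 g106 probes/CHECKS-g106.md, approved by critic row 1463;
same namespace `…Theorems.BoundedResponse.HeatSpreading` and opens throughout; all FQNs unchanged; bodies verbatim.  See part A for the full header.  0 sorry; standard axioms.
-/

noncomputable section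

open MeasureTheory ProbabilityTheory Filter Topology Set Function
open scoped NNReal ENNReal
open Literature.MathematicalPhysics.KineticTheory.HeatConduction
open Literature.MathematicalPhysics.KineticTheory OscillatorChain
open Summit.AtomisticToContinuum.FouriersLaw.Theorems.SubdiffusiveBondHeat
open Summit.AtomisticToContinuum.FouriersLaw.Theorems.SubdiffusiveBondHeat.EscapeGrading
open Summit.AtomisticToContinuum.FouriersLaw.Theorems.OddSectorIrreversibility

namespace Summit.AtomisticToContinuum.FouriersLaw.Theorems.BoundedResponse.HeatSpreading

open Summit.AtomisticToContinuum.FouriersLaw.Theses.BondHeatUncertainty (BoundedResponse SubdiffusiveBondHeat)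
open Summit.AtomisticToContinuum.FouriersLaw.Theorems.BoundedResponse.ParityFloor (exists_integral_totalCurrent_sq_gibbsMeasure_le)

/-! ## §6 Windowed algebraic decay ⟹ the two halves at grade `p + 4 − 2α` -/

/-- **`PTD_{p,α} ⟹ TT_{p+4−2α}`** for `α > 1`: `cN²·R_N(cN²) ≤ cN²·A N^p ∫_{cN²}^∞ s^{−α} = (A c^{2−α}/(α−1))·N^{p+4−2α}`. [folklore] -/
theorem thoulessTailCeiling_of_postTransitDecay {p α : ℝ} (hα : 1 < α) (hD : PostTransitDecay p α) :
    ThoulessTailCeiling (p + 4 - 2 * α) := by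
  intro ω₂ lam β γ hω hl hβ hγ T hT c hc
  obtain ⟨a, A, ha, N₀, hdec⟩ := hD ω₂ lam β γ hω hl hβ hγ T hT
  refine ⟨max A 0 * c ^ (2 - α) / (α - 1), max N₀ (max 1 ⌈a / c⌉₊), fun N hN => ?_⟩
  have hN₀ : N₀ ≤ N := le_trans (le_max_left _ _) hN
  have hN1 : 1 ≤ N := le_trans (le_trans (le_max_left _ _) (le_max_right _ _)) hN
  have hNc : ⌈a / c⌉₊ ≤ N := le_trans (le_trans (le_max_right _ _) (le_max_right _ _)) hN
  have hN0 : 0 < N := by omega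
  have hNpos : (0 : ℝ) < N := by exact_mod_cast hN0
  have ht : 0 < c * (N : ℝ) ^ 2 := by positivity
  have hwin := window_le_tw hc hNc
  set t := c * (N : ℝ) ^ 2 with htdef
  set K := max A 0 * (N : ℝ) ^ p with hKdef
  have hK0 : 0 ≤ K := mul_nonneg (le_max_right _ _) (Real.rpow_nonneg hNpos.le p)
  have hφi : IntegrableOn (fun s : ℝ => K * s ^ (-α)) (Ioi t) := (integrableOn_Ioi_rpow_of_lt (by linarith) ht).const_mul K
  have hφ : ∀ s ∈ Ioi t, |totalAutocorr ω₂ lam β γ T N s| ≤ K * s ^ (-α) := by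
    intro s hs
    have hs0 : 0 ≤ s := ht.le.trans (le_of_lt hs)
    refine (hdec N hN₀ s (hwin.trans (le_of_lt hs))).trans ?_
    exact mul_le_mul_of_nonneg_right (mul_le_mul_of_nonneg_right (le_max_left _ _) (Real.rpow_nonneg hNpos.le p))
      (Real.rpow_nonneg hs0 _)
  have h1 := mul_gkRemainder_le_of_abs_le hω hl hβ hγ hT hN0 ht.le hφi hφ
  rw [integral_const_mul, integral_Ioi_rpow_of_lt (by linarith) ht] at h1
  have e1 : t * t ^ (-α + 1) = t ^ (2 - α) :=
    calc t * t ^ (-α + 1) = t ^ (1 : ℝ) * t ^ (-α + 1) := by rw [Real.rpow_one]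
      _ = t ^ ((1 : ℝ) + (-α + 1)) := by rw [← Real.rpow_add ht]
      _ = t ^ (2 - α) := by
          congr 1
          ring
  have e2 : t ^ (2 - α) = c ^ (2 - α) * (N : ℝ) ^ (2 * (2 - α)) := mul_sq_rpow_tw hc.le hNpos.le _
  have e3 : (N : ℝ) ^ p * (N : ℝ) ^ (2 * (2 - α)) = (N : ℝ) ^ (p + 4 - 2 * α) := by
    rw [← Real.rpow_add hNpos]
    ring_nf
  have key : t * (K * (-t ^ (-α + 1) / (-α + 1))) = max A 0 * c ^ (2 - α) / (α - 1) * (N : ℝ) ^ (p + 4 - 2 * α) := by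
    have step : t * (K * (-t ^ (-α + 1) / (-α + 1))) = K * (t * t ^ (-α + 1)) / (α - 1) := by
      rw [show (-α + 1) = -(α - 1) by ring, neg_div_neg_eq]
      ring
    rw [step, e1, e2, hKdef, ← e3]
    ring
  rw [key] at h1
  exact h1

/-- **`PTD_{p,α} ⟹ LM_{p+4−2α}`** for `α < 2` (no lower bound on `α` is needed on the bounded window):
`M_N(aN,cN²) ≤ A N^p ∫_{aN}^{cN²} s^{1−α} ≤ (A c^{2−α}/(2−α))·N^{p+4−2α}`. [folklore] -/
theorem lateMomentCeiling_of_postTransitDecay {p α : ℝ} (hα2 : α < 2) (hD : PostTransitDecay p α) :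
    LateMomentCeiling (p + 4 - 2 * α) := by
  intro ω₂ lam β γ hω hl hβ hγ T hT
  obtain ⟨a, A, ha, N₀, hdec⟩ := hD ω₂ lam β γ hω hl hβ hγ T hT
  refine ⟨a, ha, fun c hc => ⟨max A 0 * c ^ (2 - α) / (2 - α), max N₀ (max 1 ⌈a / c⌉₊), fun N hN => ?_⟩⟩
  have hN₀ : N₀ ≤ N := le_trans (le_max_left _ _) hN
  have hN1 : 1 ≤ N := le_trans (le_trans (le_max_left _ _) (le_max_right _ _)) hN
  have hNc : ⌈a / c⌉₊ ≤ N := le_trans (le_trans (le_max_right _ _) (le_max_right _ _)) hN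
  have hN0 : 0 < N := by omega
  have hNpos : (0 : ℝ) < N := by exact_mod_cast hN0
  have ht : 0 < c * (N : ℝ) ^ 2 := by positivity
  have haN : 0 < a * (N : ℝ) := by positivity
  have hwin := window_le_tw hc hNc
  set t := c * (N : ℝ) ^ 2 with htdef
  set K := max A 0 * (N : ℝ) ^ p with hKdef
  have hK0 : 0 ≤ K := mul_nonneg (le_max_right _ _) (Real.rpow_nonneg hNpos.le p)
  -- the comparison function `s ↦ K s^{1−α}` on the window (away from `0`)
  have h0 : (0 : ℝ) ∉ uIcc (a * (N : ℝ)) t := by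
    rw [uIcc_of_le hwin]
    exact fun h => (lt_irrefl (0 : ℝ)) (haN.trans_le h.1)
  have hii : IntervalIntegrable (fun s : ℝ => s ^ (1 - α)) volume (a * N) t :=
    intervalIntegral.intervalIntegrable_rpow (Or.inr h0)
  have hφi' : IntegrableOn (fun s : ℝ => K * s ^ (1 - α)) (Ioc (a * N) t) :=
    ((intervalIntegrable_iff_integrableOn_Ioc_of_le hwin).1 hii).const_mul K
  have hφi : IntegrableOn (fun s : ℝ => s * (K * s ^ (-α))) (Ioc (a * N) t) := by
    refine hφi'.congr_fun (fun s hs => ?_) measurableSet_Ioc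
    have hs : 0 < s := haN.trans hs.1
    show K * s ^ (1 - α) = s * (K * s ^ (-α))
    rw [show (1 : ℝ) - α = 1 + (-α) by ring, Real.rpow_add hs, Real.rpow_one]
    ring
  have hφ : ∀ s ∈ Ioc (a * (N : ℝ)) t, |totalAutocorr ω₂ lam β γ T N s| ≤ K * s ^ (-α) := by
    intro s hs
    have hs0 : 0 ≤ s := haN.le.trans hs.1.le
    refine (hdec N hN₀ s hs.1.le).trans ?_
    exact mul_le_mul_of_nonneg_right (mul_le_mul_of_nonneg_right (le_max_left _ _) (Real.rpow_nonneg hNpos.le p))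
      (Real.rpow_nonneg hs0 _)
  have h1 := gkMoment_le_of_abs_le hω hl hβ hγ hT hN0 haN.le hφi hφ
  -- evaluate the majorant
  have hcongr : ∫ s in Ioc (a * (N : ℝ)) t, s * (K * s ^ (-α)) = ∫ s in Ioc (a * (N : ℝ)) t, K * s ^ (1 - α) := by
    refine setIntegral_congr_fun measurableSet_Ioc fun s hs => ?_
    have hs : 0 < s := haN.trans hs.1
    show s * (K * s ^ (-α)) = K * s ^ (1 - α)
    rw [show (1 : ℝ) - α = 1 + (-α) by ring, Real.rpow_add hs, Real.rpow_one]
    ring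
  have hr : (1 : ℝ) - α ≠ -1 := by
    intro h
    linarith
  have hev : ∫ s in Ioc (a * (N : ℝ)) t, s * (K * s ^ (-α)) = K * ((t ^ (1 - α + 1) - (a * N) ^ (1 - α + 1)) / (1 - α + 1)) := by
    rw [hcongr, ← intervalIntegral.integral_of_le hwin, intervalIntegral.integral_const_mul, integral_rpow (Or.inr ⟨hr, h0⟩)]
  rw [hev] at h1
  have hpos : 0 < 1 - α + 1 := by linarith
  have hdrop : K * ((t ^ (1 - α + 1) - (a * N) ^ (1 - α + 1)) / (1 - α + 1)) ≤ K * (t ^ (1 - α + 1) / (1 - α + 1)) := by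
    refine mul_le_mul_of_nonneg_left ?_ hK0
    refine div_le_div_of_nonneg_right ?_ hpos.le
    linarith [Real.rpow_nonneg haN.le (1 - α + 1)]
  have e2 : t ^ (1 - α + 1) = c ^ (2 - α) * (N : ℝ) ^ (2 * (2 - α)) := by
    rw [show (1 : ℝ) - α + 1 = 2 - α by ring]
    exact mul_sq_rpow_tw hc.le hNpos.le _
  have e3 : (N : ℝ) ^ p * (N : ℝ) ^ (2 * (2 - α)) = (N : ℝ) ^ (p + 4 - 2 * α) := by
    rw [← Real.rpow_add hNpos]
    ring_nf
  have key : K * (t ^ (1 - α + 1) / (1 - α + 1)) = max A 0 * c ^ (2 - α) / (2 - α) * (N : ℝ) ^ (p + 4 - 2 * α) := by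
    rw [e2, hKdef, ← e3, show (1 : ℝ) - α + 1 = 2 - α by ring]
    ring
  rw [key] at hdrop
  exact h1.trans hdrop

/-- **`PTD_{p,α} ⟹ TC_{max(3, p+4−2α)}`** for `1 < α < 2`. [folklore] -/
theorem gkTailCeiling_of_postTransitDecay {p α : ℝ} (hα : 1 < α) (hα2 : α < 2) (hD : PostTransitDecay p α) :
    GKTailCeiling (max 3 (p + 4 - 2 * α)) := by
  have h := gkTailCeiling_of_lateMoment_thoulessTail (lateMomentCeiling_of_postTransitDecay hα2 hD)
    (thoulessTailCeiling_of_postTransitDecay hα hD)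
  rwa [max_self] at h

/-- **The grade-3 frontier `p ≤ 2α − 1`: `PTD_{p,α} ⟹ TC_3`** for `1 < α < 2`, `p + 4 − 2α ≤ 3`. [folklore] -/
theorem gkTailCeiling_three_of_postTransitDecay {p α : ℝ} (hα : 1 < α) (hα2 : α < 2) (hp : p + 4 - 2 * α ≤ 3) (hD : PostTransitDecay p α) :
    GKTailCeiling 3 := by
  have h := gkTailCeiling_of_postTransitDecay hα hα2 hD
  rwa [max_eq_left hp] at h

/-- **With (S): `SubdiffusiveBondHeat ∧ PTD_{p,α} ⟹ BoundedResponse`** on the grade-3 frontier. [folklore] -/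
theorem boundedResponse_of_subdiffusiveBondHeat_postTransitDecay {p α : ℝ} (hα : 1 < α) (hα2 : α < 2) (hp : p + 4 - 2 * α ≤ 3)
    (hS : SubdiffusiveBondHeat) (hD : PostTransitDecay p α) : BoundedResponse :=
  boundedResponse_of_subdiffusiveBondHeat_gkTailCeiling_three hS (gkTailCeiling_three_of_postTransitDecay hα hα2 hp hD)

/-! ## §7 Windowed decay at the gap rate `κ/N²` with amplitude `N^p` ⟹ grade `p + 4` -/

/-- **`PTG_p ⟹ TT_{p+4}`**: `cN²·R_N(cN²) ≤ cN²·A N^p ∫_{cN²}^∞ e^{−κs/N²} ≤ (cA/κ)·N^{p+4}`. [folklore] -/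
theorem thoulessTailCeiling_of_postTransitGapDecay {p : ℝ} (hD : PostTransitGapDecay p) : ThoulessTailCeiling (p + 4) := by
  intro ω₂ lam β γ hω hl hβ hγ T hT c hc
  obtain ⟨a, A, κ, ha, hκ, N₀, hdec⟩ := hD ω₂ lam β γ hω hl hβ hγ T hT
  refine ⟨c * max A 0 / κ, max N₀ (max 1 ⌈a / c⌉₊), fun N hN => ?_⟩
  have hN₀ : N₀ ≤ N := le_trans (le_max_left _ _) hN
  have hN1 : 1 ≤ N := le_trans (le_trans (le_max_left _ _) (le_max_right _ _)) hN
  have hNc : ⌈a / c⌉₊ ≤ N := le_trans (le_trans (le_max_right _ _) (le_max_right _ _)) hN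
  have hN0 : 0 < N := by omega
  have hNpos : (0 : ℝ) < N := by exact_mod_cast hN0
  have ht : 0 < c * (N : ℝ) ^ 2 := by positivity
  have hwin := window_le_tw hc hNc
  have hb : 0 < κ / (N : ℝ) ^ 2 := by positivity
  set t := c * (N : ℝ) ^ 2 with htdef
  set b := κ / (N : ℝ) ^ 2 with hbdef
  set K := max A 0 * (N : ℝ) ^ p with hKdef
  have hK0 : 0 ≤ K := mul_nonneg (le_max_right _ _) (Real.rpow_nonneg hNpos.le p)
  have hφi : IntegrableOn (fun s : ℝ => K * Real.exp (-b * s)) (Ioi t) := (exp_neg_integrableOn_Ioi t hb).const_mul K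
  have hφ : ∀ s ∈ Ioi t, |totalAutocorr ω₂ lam β γ T N s| ≤ K * Real.exp (-b * s) := by
    intro s hs
    refine (hdec N hN₀ s (hwin.trans (le_of_lt hs))).trans ?_
    exact mul_le_mul_of_nonneg_right (mul_le_mul_of_nonneg_right (le_max_left _ _) (Real.rpow_nonneg hNpos.le p))
      (Real.exp_nonneg _)
  have h1 := mul_gkRemainder_le_of_abs_le hω hl hβ hγ hT hN0 ht.le hφi hφ
  have hev : ∫ s in Ioi t, K * Real.exp (-b * s) = K * (-Real.exp (-b * t) / (-b)) := by
    rw [integral_const_mul, integral_exp_mul_Ioi (by linarith) t]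
  rw [hev] at h1
  have hexp : Real.exp (-b * t) ≤ 1 := by
    rw [Real.exp_le_one_iff]
    nlinarith
  have h2 : K * (-Real.exp (-b * t) / (-b)) ≤ K * (1 / b) := by
    refine mul_le_mul_of_nonneg_left ?_ hK0
    rw [neg_div_neg_eq]
    exact div_le_div_of_nonneg_right hexp hb.le
  have h3 : t * (K * (1 / b)) = c * max A 0 / κ * (N : ℝ) ^ (p + 4) := by
    rw [hKdef, hbdef, htdef, Real.rpow_add hNpos, show (4 : ℝ) = ((4 : ℕ) : ℝ) by norm_num, Real.rpow_natCast, one_div_div]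
    ring
  calc t * gkRemainder ω₂ lam β γ T N t ≤ t * (K * (-Real.exp (-b * t) / (-b))) := h1
    _ ≤ t * (K * (1 / b)) := mul_le_mul_of_nonneg_left h2 ht.le
    _ = c * max A 0 / κ * (N : ℝ) ^ (p + 4) := h3

/-- **`PTG_p ⟹ LM_{p+4}`**: `M_N(aN,cN²) ≤ cN²·A N^p ∫_{aN}^∞ e^{−κs/N²} ≤ (cA/κ)·N^{p+4}`. [folklore] -/
theorem lateMomentCeiling_of_postTransitGapDecay {p : ℝ} (hD : PostTransitGapDecay p) : LateMomentCeiling (p + 4) := by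
  intro ω₂ lam β γ hω hl hβ hγ T hT
  obtain ⟨a, A, κ, ha, hκ, N₀, hdec⟩ := hD ω₂ lam β γ hω hl hβ hγ T hT
  refine ⟨a, ha, fun c hc => ⟨c * max A 0 / κ, max N₀ (max 1 ⌈a / c⌉₊), fun N hN => ?_⟩⟩
  have hN₀ : N₀ ≤ N := le_trans (le_max_left _ _) hN
  have hN1 : 1 ≤ N := le_trans (le_trans (le_max_left _ _) (le_max_right _ _)) hN
  have hNc : ⌈a / c⌉₊ ≤ N := le_trans (le_trans (le_max_right _ _) (le_max_right _ _)) hN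
  have hN0 : 0 < N := by omega
  have hNpos : (0 : ℝ) < N := by exact_mod_cast hN0
  have ht : 0 < c * (N : ℝ) ^ 2 := by positivity
  have haN : 0 < a * (N : ℝ) := by positivity
  have hwin := window_le_tw hc hNc
  have hb : 0 < κ / (N : ℝ) ^ 2 := by positivity
  set t := c * (N : ℝ) ^ 2 with htdef
  set b := κ / (N : ℝ) ^ 2 with hbdef
  set K := max A 0 * (N : ℝ) ^ p with hKdef
  have hK0 : 0 ≤ K := mul_nonneg (le_max_right _ _) (Real.rpow_nonneg hNpos.le p)
  have hφi : IntegrableOn (fun s : ℝ => K * Real.exp (-b * s)) (Ioi (a * N)) := (exp_neg_integrableOn_Ioi _ hb).const_mul K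
  have hφ0 : ∀ s ∈ Ioi (a * (N : ℝ)), 0 ≤ K * Real.exp (-b * s) := fun s _ => mul_nonneg hK0 (Real.exp_nonneg _)
  have hφ : ∀ s ∈ Ioc (a * (N : ℝ)) t, |totalAutocorr ω₂ lam β γ T N s| ≤ K * Real.exp (-b * s) := by
    intro s hs
    refine (hdec N hN₀ s hs.1.le).trans ?_
    exact mul_le_mul_of_nonneg_right (mul_le_mul_of_nonneg_right (le_max_left _ _) (Real.rpow_nonneg hNpos.le p))
      (Real.exp_nonneg _)
  have h1 := gkMoment_le_mul_of_abs_le hω hl hβ hγ hT hN0 haN.le hwin hφi hφ0 hφ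
  have hev : ∫ s in Ioi (a * (N : ℝ)), K * Real.exp (-b * s) = K * (-Real.exp (-b * (a * N)) / (-b)) := by
    rw [integral_const_mul, integral_exp_mul_Ioi (by linarith) (a * N)]
  rw [hev] at h1
  have hexp : Real.exp (-b * (a * N)) ≤ 1 := by
    rw [Real.exp_le_one_iff]
    nlinarith
  have h2 : K * (-Real.exp (-b * (a * N)) / (-b)) ≤ K * (1 / b) := by
    refine mul_le_mul_of_nonneg_left ?_ hK0
    rw [neg_div_neg_eq]
    exact div_le_div_of_nonneg_right hexp hb.le
  have h3 : t * (K * (1 / b)) = c * max A 0 / κ * (N : ℝ) ^ (p + 4) := by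
    rw [hKdef, hbdef, htdef, Real.rpow_add hNpos, show (4 : ℝ) = ((4 : ℕ) : ℝ) by norm_num, Real.rpow_natCast, one_div_div]
    ring
  calc gkMoment ω₂ lam β γ T N (a * N) t ≤ t * (K * (-Real.exp (-b * (a * N)) / (-b))) := h1
    _ ≤ t * (K * (1 / b)) := mul_le_mul_of_nonneg_left h2 ht.le
    _ = c * max A 0 / κ * (N : ℝ) ^ (p + 4) := h3

/-- **`PTG_p ⟹ TC_{max(3, p+4)}`** — the «gap × amplitude» grade. [folklore] -/
theorem gkTailCeiling_of_postTransitGapDecay {p : ℝ} (hD : PostTransitGapDecay p) : GKTailCeiling (max 3 (p + 4)) := by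
  have h := gkTailCeiling_of_lateMoment_thoulessTail (lateMomentCeiling_of_postTransitGapDecay hD)
    (thoulessTailCeiling_of_postTransitGapDecay hD)
  rwa [max_self] at h

/-- **Amplitude `1/N` at the gap rate suffices: `PTG_p ⟹ TC_3` for `p ≤ −1`.** [folklore] -/
theorem gkTailCeiling_three_of_postTransitGapDecay {p : ℝ} (hp : p ≤ -1) (hD : PostTransitGapDecay p) : GKTailCeiling 3 := by
  have h := gkTailCeiling_of_postTransitGapDecay hD
  rwa [max_eq_left (by linarith : p + 4 ≤ 3)] at h

/-- **With (S): `SubdiffusiveBondHeat ∧ PTG_p ⟹ BoundedResponse`** for `p ≤ −1`. [folklore] -/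
theorem boundedResponse_of_subdiffusiveBondHeat_postTransitGapDecay {p : ℝ} (hp : p ≤ -1) (hS : SubdiffusiveBondHeat)
    (hD : PostTransitGapDecay p) : BoundedResponse :=
  boundedResponse_of_subdiffusiveBondHeat_gkTailCeiling_three hS (gkTailCeiling_three_of_postTransitGapDecay hp hD)

end Summit.AtomisticToContinuum.FouriersLaw.Theorems.BoundedResponse.HeatSpreading

end
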